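import Literature.Geometry.Lorentzian.ChartMetricCoord
import Literature.Geometry.Lorentzian.ConformalCoordWeyl
import Literature.Geometry.Riemannian.WeylEnergy
import HarnessLib

/-!
# The frame Weyl tensor of a metric on `U : Opens E` is the coordinate Weyl endomorphism of its
# components; pointwise conformal covariance `W_{a²g}(e/a) = a⁻² W_g(e)` of the frame components

Link file (everything proved; no definition, no statement of `Prop` type) between

* the frame Weyl tensor `g.weylFrame x e i j k l` of a metric with its Levi-Civita connection
  (`Riemannian/WeylEnergy.lean`: `W_{ijkl} = R_{ijkl} − (1/(m−2))(Ric_{il}δ_{jk} + …) + (S/((m−1)(m−2)))(δ_{il}δ_{jk} − δ_{ik}δ_{jl})`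
  for a frame `e : ι → T_x M`, `m = |ι|`), here for a `C^∞` metric `g` on an open subset
  `U : Opens E` of the model space with representative `G` (`g.val y = G y`,
  `ChartMetricCoord.lean`: `riemann_eq_riemAt`, `ricci_eq_ricAt`, `scalarCurvature_eq_scalAt`), and
* the coordinate Weyl endomorphism `MetricCoord.weylAt G x X Y` of the components
  (`CoordWeyl.lean`) with its lowered form `IsMetricOn.apply_weylAt` and its conformal invariance
  `W' = W` for `G' = c · G` (`ConformalCoordWeyl.lean`, Besse 1987, Thm. 1.159).

Results:

* `OpensChart.curvatureForm_eq_apply_riemAt` — `Rm(X,Y,Z,W) = G(riemAt X Y Z, W)`;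
* `OpensChart.weylFrame_eq_apply_weylAt` — for a `g_x`-ORTHONORMAL frame `e` of size `dim E`:
  `W_{ijkl}(e) = G_x(weylAt G x eᵢ eⱼ e_k, e_l)` (the two Weyl tensors of the tree agree);
* `OpensChart.weylFrame_conformal` — **pointwise conformal covariance of the frame components**:
  if `g'` is a second metric on `U` with representative `c · G` and `c(x) = a²`, then the frame
  `e/a` is `g'_x`-orthonormal (`isOrthonormalFrame_conformal`) and
  `W'_{ijkl}(e/a) = a⁻² W_{ijkl}(e)` (`m ≥ 3`); hence
  `OpensChart.weylNormSqFrame_conformal`: `Σ W'(e/a)² = a⁻⁴ Σ W(e)²`, i.e. `|W_{u²g}|² = u⁻⁴|W_g|²`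
  pointwise for `c = u²` — the pointwise half of the conformal invariance of `∫|W|² dμ` in
  dimension four (`dμ_{u²g} = u⁴ dμ_g`, `ConformalVolume.lean`; Gursky–LeBrun 1999, §3).

## References

* A. L. Besse, *Einstein manifolds*, Springer 1987, 1.116–1.117, Thm. 1.159. [Besse1987]
* M. J. Gursky, C. LeBrun, Ann. Global Anal. Geom. 17 (1999) 315–328 (arXiv:math/9807055), §3.
  [GurskyLebrun1999]
-/

noncomputable section

set_option maxSynthPendingDepth 3

open Bundle Set Function Filter ContinuousLinearMap TopologicalSpace Module
open scoped Manifold ContDiff Topology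

namespace Literature.Geometry.Lorentzian

namespace OpensChart

variable {E : Type*} [NormedAddCommGroup E] [NormedSpace ℝ E] [FiniteDimensional ℝ E]
  [CompleteSpace E] {U : Opens E}
  {g : PseudoRiemannianMetric 𝓘(ℝ, E) ∞ E (TangentSpace 𝓘(ℝ, E) : U → Type _)}
  {G : E → E →L[ℝ] E →L[ℝ] ℝ} (hG : ∀ y : U, g.val y = G y)

include hG

/-- **`Rm(X,Y,Z,W) = G(riemAt X Y Z, W)`**: the covariant curvature tensor of the Levi-Civita
connection of `g` is the lowered coordinate curvature of the components (`riemann_eq_riemAt`).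
[cite: ONeill1983, Ch. 3, Lemma 3.38] -/
theorem curvatureForm_eq_apply_riemAt [g.HasLeviCivita] (x : U) (X Y Z W : E) :
    g.curvatureForm g.leviCivita x X Y Z W = G x (MetricCoord.riemAt G x X Y Z) W := by
  unfold PseudoRiemannianMetric.curvatureForm
  rw [show g.leviCivita.curvature x X Y Z = g.riemann x X Y Z from rfl, riemann_eq_riemAt hG x,
    hG x]
  rfl

/-- **The frame Weyl tensor is the lowered coordinate Weyl endomorphism**: for a
`g_x`-orthonormal frame `e : ι → T_x U = E` with `|ι| = dim E`,
`W_{ijkl}(e) = G_x(weylAt G x eᵢ eⱼ e_k, e_l)` — `weylFrame_apply` versus `IsMetricOn.apply_weylAt`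
with `G(e_a, e_b) = δ_{ab}`. [cite: Besse1987, (1.116)–1.117] -/
theorem weylFrame_eq_apply_weylAt [g.HasLeviCivita] (x : U) {ι : Type*} [Fintype ι] [DecidableEq ι]
    {e : ι → E} (he : g.IsOrthonormalFrame x e) (hι : Fintype.card ι = Module.finrank ℝ E)
    (i j k l : ι) :
    g.weylFrame x e i j k l = G x (MetricCoord.weylAt G x (e i) (e j) (e k)) (e l) := by
  have hδ : ∀ a b, G x (e a) (e b) = if a = b then 1 else 0 := by
    intro a b
    rw [← hG x]
    split_ifs with hab
    · subst hab; exact he.1 a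
    · exact he.2 a b hab
  rw [PseudoRiemannianMetric.weylFrame_apply, (isMetricOn_repr hG).apply_weylAt x.2,
    curvatureForm_eq_apply_riemAt hG, ricci_eq_ricAt hG, ricci_eq_ricAt hG, ricci_eq_ricAt hG,
    ricci_eq_ricAt hG, scalarCurvature_eq_scalAt hG, hι]
  simp only [hδ, one_div]

omit [FiniteDimensional ℝ E] [CompleteSpace E] in
/-- **Rescaled frames of a conformal metric**: if `g'_x = c(x) g_x` with `c(x) = a²`, `a ≠ 0`,
and `e` is `g_x`-orthonormal, then `e/a` is `g'_x`-orthonormal. [folklore] -/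
theorem isOrthonormalFrame_conformal
    {g' : PseudoRiemannianMetric 𝓘(ℝ, E) ∞ E (TangentSpace 𝓘(ℝ, E) : U → Type _)} {c : E → ℝ}
    (hG' : ∀ y : U, g'.val y = (fun y ↦ c y • G y) y) (x : U) {a : ℝ} (ha : a ≠ 0)
    (hax : c x = a ^ 2) {ι : Type*} {e : ι → E} (he : g.IsOrthonormalFrame x e) :
    g'.IsOrthonormalFrame x (fun i ↦ a⁻¹ • e i) := by
  have hval : ∀ v w : E, g'.val x v w = c x * G x v w := fun v w ↦ by
    rw [hG' x]; rfl
  have hsc : ∀ i j, g'.val x (a⁻¹ • e i) (a⁻¹ • e j) = c x * (a⁻¹ * (a⁻¹ * G x (e i) (e j))) := by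
    intro i j
    rw [hval]
    simp only [map_smul, _root_.smul_apply, smul_eq_mul]
  have h1 : ∀ i, G x (e i) (e i) = 1 := fun i ↦ by
    have h := he.1 i
    rwa [hG x] at h
  have h2 : ∀ i j, i ≠ j → G x (e i) (e j) = 0 := fun i j hij ↦ by
    have h := he.2 i j hij
    rwa [hG x] at h
  refine ⟨fun i ↦ ?_, fun i j hij ↦ ?_⟩
  · show g'.val x (a⁻¹ • e i) (a⁻¹ • e i) = 1
    rw [hsc, h1 i, hax]
    field_simp
  · show g'.val x (a⁻¹ • e i) (a⁻¹ • e j) = 0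
    rw [hsc, h2 i j hij]
    ring

/-- **Pointwise conformal covariance of the frame Weyl components**: for two `C^∞` metrics
`g, g'` on `U` with representatives `G` and `c · G` (`c` smooth and nowhere zero on `U`),
`c(x) = a²`, `m = dim E ≥ 3`, and a `g_x`-orthonormal frame `e` of size `m`:
`W'_{ijkl}(e/a) = a⁻² W_{ijkl}(e)` — `W' = W` as endomorphisms (`IsMetricOn.weylAt_conformal`,
Besse 1987, Thm. 1.159), lowered with `g' = a² g` and evaluated on the rescaled frame.
[cite: Besse1987, Thm. 1.159] -/
theorem weylFrame_conformal [g.HasLeviCivita]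
    {g' : PseudoRiemannianMetric 𝓘(ℝ, E) ∞ E (TangentSpace 𝓘(ℝ, E) : U → Type _)} [g'.HasLeviCivita]
    {c : E → ℝ} (hG' : ∀ y : U, g'.val y = (fun y ↦ c y • G y) y)
    (hc : ContDiffOn ℝ ∞ c (U : Set E)) (hc0 : ∀ y ∈ (U : Set E), c y ≠ 0)
    (hm : 3 ≤ Module.finrank ℝ E) (x : U) {a : ℝ} (ha : a ≠ 0) (hax : c x = a ^ 2)
    {ι : Type*} [Fintype ι] [DecidableEq ι] {e : ι → E} (he : g.IsOrthonormalFrame x e)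
    (hι : Fintype.card ι = Module.finrank ℝ E) (i j k l : ι) :
    g'.weylFrame x (fun i ↦ a⁻¹ • e i) i j k l = (a ^ 2)⁻¹ * g.weylFrame x e i j k l := by
  have he' := isOrthonormalFrame_conformal hG hG' x ha hax he
  rw [weylFrame_eq_apply_weylAt (G := fun y ↦ c y • G y) hG' x he' hι,
    weylFrame_eq_apply_weylAt hG x he hι,
    (isMetricOn_repr hG).conformal_apply_weylAt_conformal hc hc0 x.2 hm, hax,
    MetricCoord.weylAt_smul_left, MetricCoord.weylAt_smul_right]
  simp only [map_smul, _root_.smul_apply, smul_eq_mul]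
  field_simp

/-- Hence **`|W'|²(e/a) = a⁻⁴ |W|²(e)`** for the frame norms `Σ W²` (`weylNormSqFrame`): for
`c = u²` (`a = u`), `|W_{u²g}|² = u⁻⁴ |W_g|²` pointwise — with `dμ_{u²g} = u⁴ dμ_g` in dimension
four, the conformal invariance of `∫|W|² dμ` (Gursky–LeBrun 1999, §3). [cite: Besse1987, Thm. 1.159]
[cite: GurskyLebrun1999, §3, proof of Theorem 1] -/
theorem weylNormSqFrame_conformal [g.HasLeviCivita]
    {g' : PseudoRiemannianMetric 𝓘(ℝ, E) ∞ E (TangentSpace 𝓘(ℝ, E) : U → Type _)} [g'.HasLeviCivita]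
    {c : E → ℝ} (hG' : ∀ y : U, g'.val y = (fun y ↦ c y • G y) y)
    (hc : ContDiffOn ℝ ∞ c (U : Set E)) (hc0 : ∀ y ∈ (U : Set E), c y ≠ 0)
    (hm : 3 ≤ Module.finrank ℝ E) (x : U) {a : ℝ} (ha : a ≠ 0) (hax : c x = a ^ 2)
    {ι : Type*} [Fintype ι] [DecidableEq ι] {e : ι → E} (he : g.IsOrthonormalFrame x e)
    (hι : Fintype.card ι = Module.finrank ℝ E) :
    g'.weylNormSqFrame x (fun i ↦ a⁻¹ • e i) = (a ^ 4)⁻¹ * g.weylNormSqFrame x e := by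
  unfold PseudoRiemannianMetric.weylNormSqFrame
  simp only [weylFrame_conformal hG hG' hc hc0 hm x ha hax he hι, mul_pow, ← Finset.mul_sum]
  congr 1
  rw [inv_pow, ← pow_mul]

end OpensChart

end Literature.Geometry.Lorentzian

end
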